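import Summits.NavierStokesRegularity.NavierStokesRegularity.Theorems.TypeICertificateLadderTargetSolitonLawsProfile
import HarnessLib

/-!
# Route TypeICertificateLadder — crux `Target` (item stmt-NavierStokesRegularity-1217),
# line `killing-twisted-bernoulli-solitons`: stub B3 `stub_solitonLaws`
# (the `C`-free soliton enstrophy law and identity)

Prover file (theorems only) landing stub B3 of the line: for a Type I rotated self-similar
(RSS) classical Navier–Stokes solution `u = pvAnsatz α U` on `[−1, 0)` (Pineau–Vicol,
arXiv:2607.09619, (1.7)) and a "conjugate density" `m` — a positive, normalised `C²` weight with
Gaussian bounds on `m`, `∇m`, in the kernel of the adjoint of `L_α = −Δ + (U + ½y − αJy)·∇` — the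
twisted head identity `L_αΠ_α = −|curl U|² + 2α(curl U)₂` (stub B1, taken as the HYPOTHESIS of
B3) integrates against `m` to the **identity** `∫|curl U|²m = 2α∫(curl U)₂m`, and Cauchy–Schwarz
in the probability measure `m dy` gives the **law** `∫|curl U|²m ≤ 4α²`.

* `contDiff_twistedHead`, `norm_fderiv_twistedHead_le`, `twistedHead_growth` — the twisted head
  pressure `Π_α = ½|U|² + P + ½y·U − α⟪Jy, U⟫` is smooth with `‖∇Π_α‖ = O(1 + |y|)`,
  `|Π_α| = O((1 + |y|)²)` along a solution of the profile system (1.8a) with bounded `U, DU, ΔU`;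
* `twisted_integrability`, `weighted_twisted_identity` — every integrand of the pairing is
  `O((1 + |y|)³e^{−|y|²/32})`, so `∫ m L_αΠ_α = 0`
  (`PineauVicol2026.integral_weight_mul_drift_eq_zero`) and the identity follows;
* `stub_solitonLaws` — the registered stub, assembled with `rss_profile_system`,
  `rss_profile_bounds` and `integral_curl_sq_mul_le_of_identity` of
  `TypeICertificateLadderTargetSolitonLawsProfile.lean`.
-/

noncomputable section

namespace Summit.NavierStokesRegularity.NavierStokesRegularity.Theorems

open Set Function Filter MeasureTheory InnerProductSpace
open Literature.Analysis.FluidPDE Literature.Analysis.FluidPDE.PineauVicol2026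
open scoped RealInnerProductSpace Laplacian ContDiff Topology

/-- The twisted head pressure `Π_α = ½|U|² + P + ½ y·U − α⟪Jy, U⟫` of smooth `U`, `P` is
smooth. [folklore] -/
theorem contDiff_twistedHead {U : EuclideanSpace ℝ (Fin 3) → EuclideanSpace ℝ (Fin 3)}
    {P : EuclideanSpace ℝ (Fin 3) → ℝ}
    (hU : ContDiff ℝ ∞ U) (hP : ContDiff ℝ ∞ P) (α : ℝ) :
    ContDiff ℝ ∞ (fun z => headPressure (1 / 2) U P z - α * ⟪rotGen z, U z⟫) :=
  (contDiff_headPressure hU hP _).sub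
    (contDiff_const.mul (rotGenL.contDiff.inner ℝ hU) : ContDiff ℝ ∞ fun z => α * ⟪rotGen z, U z⟫)

/-- **The gradient of the twisted head pressure**: for smooth `U`, `P`,
`‖DΠ_α(y)‖ ≤ ‖U‖‖DU‖ + ‖DP‖ + (½ + |α|)(‖U‖ + ‖y‖‖DU‖)` at `y`
(`DΠ_α(y)h = ⟪U, DU h⟫ + DP h + ½(⟪y, DU h⟫ + ⟪h, U⟫) − α(⟪Jy, DU h⟫ + ⟪Jh, U⟫)`,
`‖J v‖ ≤ ‖v‖`). [folklore] -/
theorem norm_fderiv_twistedHead_le {U : EuclideanSpace ℝ (Fin 3) → EuclideanSpace ℝ (Fin 3)}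
    {P : EuclideanSpace ℝ (Fin 3) → ℝ}
    (hU : ContDiff ℝ ∞ U) (hP : ContDiff ℝ ∞ P) (α : ℝ) (y : EuclideanSpace ℝ (Fin 3)) :
    ‖fderiv ℝ (fun z => headPressure (1 / 2) U P z - α * ⟪rotGen z, U z⟫) y‖ ≤
      ‖U y‖ * ‖fderiv ℝ U y‖ + ‖fderiv ℝ P y‖ +
        (1 / 2 + |α|) * (‖U y‖ + ‖y‖ * ‖fderiv ℝ U y‖) := by
  have hUy : HasFDerivAt U (fderiv ℝ U y) y := ((hU.differentiable (by simp)) y).hasFDerivAt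
  have hPy : HasFDerivAt P (fderiv ℝ P y) y := ((hP.differentiable (by simp)) y).hasFDerivAt
  have h1 := hUy.norm_sq.const_mul (2⁻¹ : ℝ)
  have h3 := ((hasFDerivAt_id y).inner ℝ hUy).const_mul (1 / 2 : ℝ)
  have h4 : HasFDerivAt (fun z => ⟪rotGen z, U z⟫)
      ((fderivInnerCLM ℝ (rotGen y, U y)).comp (rotGenL.prod (fderiv ℝ U y))) y := by
    have h := (rotGenL.hasFDerivAt (x := y)).inner ℝ hUy
    simpa only [rotGenL_apply] using h
  have htot : HasFDerivAt
      (fun z => 2⁻¹ * ‖U z‖ ^ 2 + P z + (1 / 2 : ℝ) * ⟪id z, U z⟫ - α * ⟪rotGen z, U z⟫) _ y :=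
    ((h1.fun_add hPy).fun_add h3).fun_sub (h4.const_mul α)
  have e : (fun z => headPressure (1 / 2) U P z - α * ⟪rotGen z, U z⟫) =
      fun z => 2⁻¹ * ‖U z‖ ^ 2 + P z + (1 / 2 : ℝ) * ⟪id z, U z⟫ - α * ⟪rotGen z, U z⟫ := by
    funext z; rw [headPressure_apply]; rfl
  rw [e, htot.fderiv]
  refine ContinuousLinearMap.opNorm_le_bound _ (by positivity) fun h => ?_
  simp only [sub_apply, add_apply, FunLike.coe_smul, Pi.smul_apply,
    ContinuousLinearMap.coe_comp, Function.comp_apply, ContinuousLinearMap.prod_apply,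
    ContinuousLinearMap.id_apply, fderivInnerCLM_apply, rotGenL_apply, smul_eq_mul,
    nsmul_eq_mul, Nat.cast_ofNat, id]
  have hJy := norm_rotGen_le y
  have hJh := norm_rotGen_le h
  have hDUh : ‖fderiv ℝ U y h‖ ≤ ‖fderiv ℝ U y‖ * ‖h‖ := ContinuousLinearMap.le_opNorm _ _
  have i1 : |⟪U y, fderiv ℝ U y h⟫| ≤ ‖U y‖ * (‖fderiv ℝ U y‖ * ‖h‖) :=
    (abs_real_inner_le_norm _ _).trans (mul_le_mul_of_nonneg_left hDUh (norm_nonneg _))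
  have i2 : |fderiv ℝ P y h| ≤ ‖fderiv ℝ P y‖ * ‖h‖ := by
    rw [← Real.norm_eq_abs]; exact ContinuousLinearMap.le_opNorm _ _
  have i3 : |⟪y, fderiv ℝ U y h⟫ + ⟪h, U y⟫| ≤ ‖y‖ * (‖fderiv ℝ U y‖ * ‖h‖) + ‖h‖ * ‖U y‖ :=
    (abs_add_le _ _).trans (add_le_add
      ((abs_real_inner_le_norm _ _).trans (mul_le_mul_of_nonneg_left hDUh (norm_nonneg _)))
      (abs_real_inner_le_norm _ _))
  have i4 : |⟪rotGen y, fderiv ℝ U y h⟫ + ⟪rotGen h, U y⟫| ≤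
      ‖y‖ * (‖fderiv ℝ U y‖ * ‖h‖) + ‖h‖ * ‖U y‖ :=
    (abs_add_le _ _).trans (add_le_add
      ((abs_real_inner_le_norm _ _).trans (mul_le_mul hJy hDUh (norm_nonneg _) (norm_nonneg _)))
      ((abs_real_inner_le_norm _ _).trans (mul_le_mul_of_nonneg_right hJh (norm_nonneg _))))
  rw [Real.norm_eq_abs]
  calc |2⁻¹ * (2 * ⟪U y, fderiv ℝ U y h⟫) + fderiv ℝ P y h +
          1 / 2 * (⟪y, fderiv ℝ U y h⟫ + ⟪h, U y⟫) -
          α * (⟪rotGen y, fderiv ℝ U y h⟫ + ⟪rotGen h, U y⟫)|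
      ≤ |⟪U y, fderiv ℝ U y h⟫| + |fderiv ℝ P y h| +
          1 / 2 * |⟪y, fderiv ℝ U y h⟫ + ⟪h, U y⟫| +
          |α| * |⟪rotGen y, fderiv ℝ U y h⟫ + ⟪rotGen h, U y⟫| := by
        refine (abs_sub _ _).trans (add_le_add ((abs_add_le _ _).trans (add_le_add
          ((abs_add_le _ _).trans (add_le_add (le_of_eq ?_) le_rfl)) (le_of_eq ?_))) (le_of_eq ?_))
        · rw [← mul_assoc, inv_mul_cancel₀ (two_ne_zero), one_mul]
        · rw [abs_mul, abs_of_nonneg (by norm_num : (0 : ℝ) ≤ 1 / 2)]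
        · rw [abs_mul]
    _ ≤ ‖U y‖ * (‖fderiv ℝ U y‖ * ‖h‖) + ‖fderiv ℝ P y‖ * ‖h‖ +
          1 / 2 * (‖y‖ * (‖fderiv ℝ U y‖ * ‖h‖) + ‖h‖ * ‖U y‖) +
          |α| * (‖y‖ * (‖fderiv ℝ U y‖ * ‖h‖) + ‖h‖ * ‖U y‖) := by
        gcongr
    _ = (‖U y‖ * ‖fderiv ℝ U y‖ + ‖fderiv ℝ P y‖ +
          (1 / 2 + |α|) * (‖U y‖ + ‖y‖ * ‖fderiv ℝ U y‖)) * ‖h‖ := by ring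

/-- **Growth of the twisted head pressure.** For a smooth solution `(U, P)` of the RSS profile
system (1.8a) with `‖U‖ ≤ C₀`, `‖DU‖, ‖ΔU‖ ≤ K`, the twisted head pressure
`Π_α = ½|U|² + P + ½y·U − α⟪Jy, U⟫` satisfies `‖∇Π_α(y)‖ ≤ A(1 + |y|)` and
`|Π_α(y)| ≤ A(1 + |y|)²` for some `A ≥ 0` (`norm_gradient_pressure_le`,
`norm_fderiv_twistedHead_le`, `abs_le_of_norm_fderiv_le_linear`). [folklore] -/
theorem twistedHead_growth {α C₀ K : ℝ} {U : EuclideanSpace ℝ (Fin 3) → EuclideanSpace ℝ (Fin 3)}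
    {P : EuclideanSpace ℝ (Fin 3) → ℝ}
    (hU : ContDiff ℝ ∞ U) (hP : ContDiff ℝ ∞ P)
    (hC₀ : 0 ≤ C₀) (hK : 0 ≤ K) (hUb : ∀ y, ‖U y‖ ≤ C₀) (hDU : ∀ y, ‖fderiv ℝ U y‖ ≤ K)
    (hΔU : ∀ y, ‖(Δ U) y‖ ≤ K)
    (heq : ∀ y, α • (rotGen (U y) - fderiv ℝ U y (rotGen y)) + (1 / 2 : ℝ) • U y +
      (1 / 2 : ℝ) • fderiv ℝ U y y - (Δ U) y + fderiv ℝ U y (U y) + gradient P y = 0) :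
    ∃ A : ℝ, 0 ≤ A ∧ ∀ y,
      ‖gradient (fun z => headPressure (1 / 2) U P z - α * ⟪rotGen z, U z⟫) y‖ ≤ A * (1 + ‖y‖) ∧
      |headPressure (1 / 2) U P y - α * ⟪rotGen y, U y⟫| ≤ A * (1 + ‖y‖) ^ 2 := by
  set H : EuclideanSpace ℝ (Fin 3) → ℝ := fun z => headPressure (1 / 2) U P z - α * ⟪rotGen z, U z⟫
    with hH
  have hHs : ContDiff ℝ ∞ H := contDiff_twistedHead hU hP α
  have hp1 : ∀ y : EuclideanSpace ℝ (Fin 3), 1 ≤ 1 + ‖y‖ := fun y =>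
    le_add_of_nonneg_right (norm_nonneg y)
  set A₁ : ℝ := |α| * (C₀ + K) + C₀ + 2 * K + K * C₀ with hA₁
  have hA₁0 : 0 ≤ A₁ := by positivity
  have hgP : ∀ y, ‖fderiv ℝ P y‖ ≤ A₁ * (1 + ‖y‖) := fun y => by
    have h := norm_gradient_pressure_le hC₀ hK hUb hDU hΔU heq y
    rwa [gradient, LinearIsometryEquiv.norm_map] at h
  set A₂ : ℝ := C₀ * K + A₁ + (1 / 2 + |α|) * (C₀ + K) with hA₂
  have hA₂0 : 0 ≤ A₂ := by positivity
  have hgH : ∀ y, ‖fderiv ℝ H y‖ ≤ A₂ * (1 + ‖y‖) := fun y => by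
    refine (norm_fderiv_twistedHead_le hU hP α y).trans ?_
    have e1 : ‖U y‖ * ‖fderiv ℝ U y‖ ≤ C₀ * K := mul_le_mul (hUb y) (hDU y) (norm_nonneg _) hC₀
    have e2 : ‖U y‖ + ‖y‖ * ‖fderiv ℝ U y‖ ≤ (C₀ + K) * (1 + ‖y‖) := by
      have h := mul_le_mul_of_nonneg_left (hDU y) (norm_nonneg y)
      nlinarith [hUb y, hp1 y, norm_nonneg y]
    have e3 := hgP y
    have hα : 0 ≤ 1 / 2 + |α| := by positivity
    calc ‖U y‖ * ‖fderiv ℝ U y‖ + ‖fderiv ℝ P y‖ +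
          (1 / 2 + |α|) * (‖U y‖ + ‖y‖ * ‖fderiv ℝ U y‖)
        ≤ C₀ * K + A₁ * (1 + ‖y‖) + (1 / 2 + |α|) * ((C₀ + K) * (1 + ‖y‖)) :=
          add_le_add (add_le_add e1 e3) (mul_le_mul_of_nonneg_left e2 hα)
      _ ≤ A₂ * (1 + ‖y‖) := by
          rw [hA₂]
          nlinarith [mul_nonneg hC₀ hK, hp1 y]
  have hHb : ∀ y, |H y| ≤ (|H 0| + A₂) * (1 + ‖y‖) ^ 2 :=
    abs_le_of_norm_fderiv_le_linear (hHs.differentiable (by simp)) hA₂0 hgH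
  refine ⟨|H 0| + A₂, by positivity, fun y => ⟨?_, hHb y⟩⟩
  rw [show ‖gradient H y‖ = ‖fderiv ℝ H y‖ by rw [gradient, LinearIsometryEquiv.norm_map]]
  refine (hgH y).trans (mul_le_mul_of_nonneg_right ?_ (zero_le_one.trans (hp1 y)))
  linarith [abs_nonneg (H 0)]

/-- **Integrability package for the twisted pairing.** Under the hypotheses of
`twistedHead_growth`, for a `C²` weight `m > 0` with the Gaussian bounds
`m ≤ M₁e^{−|y|²/16}`, `‖∇m‖ ≤ M₂e^{−|y|²/32}`: the functions `|curl U|² m`, `(curl U)₂ m`,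
`|m| ‖∇Π_α‖`, `|Π_α| ‖∇m‖`, `|Π_α| |m| ‖b_α‖` (`b_α = U + ½y − αJy`) are integrable on `ℝ³` — each
is continuous and `O((1 + |y|)³ e^{−|y|²/32})`. [folklore] -/
theorem twisted_integrability {α C₀ K M₁ M₂ : ℝ}
    {U : EuclideanSpace ℝ (Fin 3) → EuclideanSpace ℝ (Fin 3)}
    {P m : EuclideanSpace ℝ (Fin 3) → ℝ}
    (hU : ContDiff ℝ ∞ U) (hP : ContDiff ℝ ∞ P) (hm : ContDiff ℝ 2 m)
    (hC₀ : 0 ≤ C₀) (hK : 0 ≤ K) (hUb : ∀ y, ‖U y‖ ≤ C₀) (hDU : ∀ y, ‖fderiv ℝ U y‖ ≤ K)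
    (hΔU : ∀ y, ‖(Δ U) y‖ ≤ K)
    (heq : ∀ y, α • (rotGen (U y) - fderiv ℝ U y (rotGen y)) + (1 / 2 : ℝ) • U y +
      (1 / 2 : ℝ) • fderiv ℝ U y y - (Δ U) y + fderiv ℝ U y (U y) + gradient P y = 0)
    (hm0 : ∀ y, 0 < m y) (hmup : ∀ y, m y ≤ M₁ * Real.exp (-(1 / 16 : ℝ) * ‖y‖ ^ 2))
    (hmD : ∀ y, ‖fderiv ℝ m y‖ ≤ M₂ * Real.exp (-(1 / 32 : ℝ) * ‖y‖ ^ 2)) :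
    Integrable (fun y => ‖curl U y‖ ^ 2 * m y) ∧ Integrable (fun y => (curl U y) 2 * m y) ∧
      Integrable (fun x => |m x| *
        ‖gradient (fun z => headPressure (1 / 2) U P z - α * ⟪rotGen z, U z⟫) x‖) ∧
      Integrable (fun x => |headPressure (1 / 2) U P x - α * ⟪rotGen x, U x⟫| *
        ‖gradient m x‖) ∧
      Integrable (fun x => |headPressure (1 / 2) U P x - α * ⟪rotGen x, U x⟫| * |m x| *
        ‖U x + (1 / 2 : ℝ) • x - α • rotGen x‖) := by
  set H : EuclideanSpace ℝ (Fin 3) → ℝ := fun z => headPressure (1 / 2) U P z - α * ⟪rotGen z, U z⟫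
    with hH
  set G : EuclideanSpace ℝ (Fin 3) → ℝ := fun y => Real.exp (-(1 / 32 : ℝ) * ‖y‖ ^ 2) with hG
  obtain ⟨A, hA0, hA⟩ := twistedHead_growth hU hP hC₀ hK hUb hDU hΔU heq (α := α)
  -- regularity
  have hHs : ContDiff ℝ ∞ H := contDiff_twistedHead hU hP α
  have hbs : ContDiff ℝ ∞ (fun z => U z + (1 / 2 : ℝ) • z - α • rotGen z) :=
    ((hU.add (contDiff_id.const_smul (1 / 2 : ℝ))).sub (rotGenL.contDiff.const_smul α) :
      ContDiff ℝ ∞ (fun z => U z + (1 / 2 : ℝ) • z - α • rotGen z))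
  have hmc : Continuous m := hm.continuous
  have hHc : Continuous H := hHs.continuous
  have hgHc : Continuous (gradient H) :=
    continuous_gradient_of_contDiff (hHs.of_le (WithTop.coe_le_coe.2 le_top))
  have hgmc : Continuous (gradient m) := continuous_gradient_of_contDiff (hm.of_le one_le_two)
  have hbc : Continuous (fun z => U z + (1 / 2 : ℝ) • z - α • rotGen z) := hbs.continuous
  have hcurlc : Continuous (curl U) := by
    have e : curl U = fun y => curlCLM (fderiv ℝ U y) := funext fun y => curl_eq_curlCLM U y
    rw [e]
    exact curlCLM.continuous.comp (hU.continuous_fderiv (by simp))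
  have hcurl3c : Continuous (fun y => (curl U y) 2) :=
    (contDiff_euclideanCoord (n := 0) (2 : Fin 3)).continuous.comp hcurlc
  -- elementary facts on the weights
  have hG0 : ∀ y, 0 < G y := fun y => Real.exp_pos _
  have hp1 : ∀ y : EuclideanSpace ℝ (Fin 3), 1 ≤ 1 + ‖y‖ := fun y =>
    le_add_of_nonneg_right (norm_nonneg y)
  have hp0 : ∀ y : EuclideanSpace ℝ (Fin 3), 0 ≤ 1 + ‖y‖ := fun y => zero_le_one.trans (hp1 y)
  have hpk : ∀ (y : EuclideanSpace ℝ (Fin 3)) (k : ℕ), k ≤ 3 → (1 + ‖y‖) ^ k ≤ (1 + ‖y‖) ^ 3 :=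
      fun y k hk =>
    pow_le_pow_right₀ (hp1 y) hk
  have hM₁ : 0 ≤ M₁ := by
    have h := (hm0 0).le.trans (hmup 0)
    simpa using h
  have hM₂ : 0 ≤ M₂ := by
    have h := (norm_nonneg _).trans (hmD 0)
    simpa using h
  have hmG : ∀ y, |m y| ≤ M₁ * G y := fun y => by
    rw [abs_of_pos (hm0 y)]
    refine (hmup y).trans (mul_le_mul_of_nonneg_left ?_ hM₁)
    exact Real.exp_le_exp.2 (by nlinarith [sq_nonneg ‖y‖])
  have hgm : ∀ y, ‖gradient m y‖ ≤ M₂ * G y := fun y => by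
    rw [show ‖gradient m y‖ = ‖fderiv ℝ m y‖ by rw [gradient, LinearIsometryEquiv.norm_map]]
    exact hmD y
  -- pointwise bounds on the profile side
  have hcurl : ∀ y, ‖curl U y‖ ≤ ‖curlCLM‖ * K := fun y =>
    (norm_curl_le U y).trans (mul_le_mul_of_nonneg_left (hDU y) (norm_nonneg curlCLM))
  have hcurl3 : ∀ y, |(curl U y) 2| ≤ ‖curlCLM‖ * K := fun y => by
    have h := PiLp.norm_apply_le (curl U y) 2
    rw [Real.norm_eq_abs] at h
    exact h.trans (hcurl y)
  set B : ℝ := C₀ + 1 / 2 + |α| with hB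
  have hB0 : 0 ≤ B := by positivity
  have hbb : ∀ y, ‖U y + (1 / 2 : ℝ) • y - α • rotGen y‖ ≤ B * (1 + ‖y‖) := fun y => by
    have h1 : ‖U y + (1 / 2 : ℝ) • y - α • rotGen y‖ ≤
        ‖U y‖ + ‖(1 / 2 : ℝ) • y‖ + ‖α • rotGen y‖ :=
      (norm_sub_le _ _).trans (add_le_add (norm_add_le _ _) le_rfl)
    rw [norm_smul, norm_smul, Real.norm_of_nonneg (by norm_num : (0 : ℝ) ≤ 1 / 2),
      Real.norm_eq_abs] at h1
    have h2 := mul_le_mul_of_nonneg_left (norm_rotGen_le y) (abs_nonneg α)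
    rw [hB]
    linarith [hUb y, abs_nonneg α, mul_nonneg hC₀ (norm_nonneg y)]
  -- integrability: every integrand is `O((1 + ‖y‖)³ G)`
  have c32 : (0 : ℝ) < 1 / 32 := by norm_num
  have key : ∀ {f : EuclideanSpace ℝ (Fin 3) → ℝ}, Continuous f → ∀ (A' : ℝ) (k : ℕ), k ≤ 3 →
      0 ≤ A' →
      (∀ y, |f y| ≤ A' * ((1 + ‖y‖) ^ k * G y)) → Integrable f := by
    intro f hf A' k hk hA' h
    refine integrable_of_norm_le_poly_mul_gauss hf A' 3 c32 fun y => ?_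
    rw [Real.norm_eq_abs]
    refine (h y).trans (mul_le_mul_of_nonneg_left ?_ hA')
    exact mul_le_mul_of_nonneg_right (hpk y k hk) (hG0 y).le
  refine ⟨?_, ?_, ?_, ?_, ?_⟩
  · refine key ((hcurlc.norm.pow 2).mul hmc) ((‖curlCLM‖ * K) ^ 2 * M₁) 0 (by norm_num)
      (by positivity) fun y => ?_
    rw [abs_mul, abs_of_nonneg (sq_nonneg _), pow_zero, one_mul]
    calc ‖curl U y‖ ^ 2 * |m y| ≤ (‖curlCLM‖ * K) ^ 2 * (M₁ * G y) :=
          mul_le_mul (pow_le_pow_left₀ (norm_nonneg _) (hcurl y) 2) (hmG y) (abs_nonneg _)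
            (by positivity)
      _ = (‖curlCLM‖ * K) ^ 2 * M₁ * G y := by ring
  · refine key (hcurl3c.mul hmc) (‖curlCLM‖ * K * M₁) 0 (by norm_num) (by positivity)
      fun y => ?_
    rw [abs_mul, pow_zero, one_mul]
    calc |(curl U y) 2| * |m y| ≤ (‖curlCLM‖ * K) * (M₁ * G y) :=
          mul_le_mul (hcurl3 y) (hmG y) (abs_nonneg _) (by positivity)
      _ = ‖curlCLM‖ * K * M₁ * G y := by ring
  · refine key ((continuous_abs.comp hmc).mul hgHc.norm) (M₁ * A) 1 (by norm_num)
      (by positivity) fun y => ?_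
    rw [abs_mul, abs_abs, abs_norm, pow_one]
    calc |m y| * ‖gradient H y‖ ≤ (M₁ * G y) * (A * (1 + ‖y‖)) :=
          mul_le_mul (hmG y) (hA y).1 (norm_nonneg _) (by positivity)
      _ = M₁ * A * ((1 + ‖y‖) * G y) := by ring
  · refine key ((continuous_abs.comp hHc).mul hgmc.norm) (A * M₂) 2 (by norm_num)
      (by positivity) fun y => ?_
    rw [abs_mul, abs_abs, abs_norm]
    have hq : 0 ≤ A * (1 + ‖y‖) ^ 2 := mul_nonneg hA0 (pow_nonneg (hp0 y) 2)
    calc |H y| * ‖gradient m y‖ ≤ (A * (1 + ‖y‖) ^ 2) * (M₂ * G y) :=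
          mul_le_mul (hA y).2 (hgm y) (norm_nonneg _) hq
      _ = A * M₂ * ((1 + ‖y‖) ^ 2 * G y) := by ring
  · refine key (((continuous_abs.comp hHc).mul (continuous_abs.comp hmc)).mul hbc.norm)
      (A * M₁ * B) 3 le_rfl (by positivity) fun y => ?_
    rw [abs_mul, abs_mul, abs_abs, abs_abs, abs_norm]
    have hq : 0 ≤ A * (1 + ‖y‖) ^ 2 := mul_nonneg hA0 (pow_nonneg (hp0 y) 2)
    have e1 : |H y| * |m y| ≤ A * (1 + ‖y‖) ^ 2 * (M₁ * G y) :=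
      mul_le_mul (hA y).2 (hmG y) (abs_nonneg (m y)) hq
    have hn : 0 ≤ ‖U y + (1 / 2 : ℝ) • y - α • rotGen y‖ :=
      norm_nonneg (U y + (1 / 2 : ℝ) • y - α • rotGen y)
    have hpos : 0 ≤ A * (1 + ‖y‖) ^ 2 * (M₁ * G y) := mul_nonneg hq (mul_nonneg hM₁ (hG0 y).le)
    calc |H y| * |m y| * ‖U y + (1 / 2 : ℝ) • y - α • rotGen y‖
        ≤ A * (1 + ‖y‖) ^ 2 * (M₁ * G y) * (B * (1 + ‖y‖)) := mul_le_mul e1 (hbb y) hn hpos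
      _ = A * M₁ * B * ((1 + ‖y‖) ^ 3 * G y) := by ring

/-- **The weighted twisted identity** (the mechanism of (5.4) of the source, twisted by the
Killing drift `−αJy`). Let `(U, P)` be a smooth solution of the RSS profile system (1.8a)
with `‖U‖ ≤ C₀`, `‖DU‖, ‖ΔU‖ ≤ K`; let `m ∈ C²` be positive with Gaussian bounds
`m ≤ M₁e^{−|y|²/16}`, `‖∇m‖ ≤ M₂e^{−|y|²/32}` in the kernel of the adjoint of
`L_α = −Δ + b_α·∇`, `b_α = U + ½y − αJy` (`Δm + ∇·(m b_α) = 0`); and suppose the pointwise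
twisted Bernoulli identity `L_αΠ_α = −|curl U|² + 2α (curl U)₂` for
`Π_α = ½|U|² + P + ½y·U − α⟪Jy, U⟫`. Then `|curl U|² m` and `(curl U)₂ m` are integrable and
`∫ |curl U|² m = 2α ∫ (curl U)₂ m` (pair `L_αΠ_α` with `m`: `∫ m L_αΠ_α = 0` by
`PineauVicol2026.integral_weight_mul_drift_eq_zero` and `twisted_integrability`).
[cite: PineauVicol2026, (5.4) (arXiv:2607.09619 p. 13)] -/
theorem weighted_twisted_identity {α C₀ K M₁ M₂ : ℝ}
    {U : EuclideanSpace ℝ (Fin 3) → EuclideanSpace ℝ (Fin 3)}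
    {P m : EuclideanSpace ℝ (Fin 3) → ℝ}
    (hU : ContDiff ℝ ∞ U) (hP : ContDiff ℝ ∞ P) (hm : ContDiff ℝ 2 m)
    (hC₀ : 0 ≤ C₀) (hK : 0 ≤ K) (hUb : ∀ y, ‖U y‖ ≤ C₀) (hDU : ∀ y, ‖fderiv ℝ U y‖ ≤ K)
    (hΔU : ∀ y, ‖(Δ U) y‖ ≤ K)
    (heq : ∀ y, α • (rotGen (U y) - fderiv ℝ U y (rotGen y)) + (1 / 2 : ℝ) • U y +
      (1 / 2 : ℝ) • fderiv ℝ U y y - (Δ U) y + fderiv ℝ U y (U y) + gradient P y = 0)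
    (hm0 : ∀ y, 0 < m y) (hmup : ∀ y, m y ≤ M₁ * Real.exp (-(1 / 16 : ℝ) * ‖y‖ ^ 2))
    (hmD : ∀ y, ‖fderiv ℝ m y‖ ≤ M₂ * Real.exp (-(1 / 32 : ℝ) * ‖y‖ ^ 2))
    (hker : ∀ y, (Δ m) y + VectorCalculus.divergence
      (fun z => m z • (U z + (1 / 2 : ℝ) • z - α • rotGen z)) y = 0)
    (hpt : ∀ y, -(Δ (fun z => headPressure (1 / 2) U P z - α * ⟪rotGen z, U z⟫)) y +
      fderiv ℝ (fun z => headPressure (1 / 2) U P z - α * ⟪rotGen z, U z⟫) y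
        (U y + (1 / 2 : ℝ) • y - α • rotGen y) = -‖curl U y‖ ^ 2 + 2 * α * (curl U y) 2) :
    Integrable (fun y => ‖curl U y‖ ^ 2 * m y) ∧ Integrable (fun y => (curl U y) 2 * m y) ∧
      ∫ y, ‖curl U y‖ ^ 2 * m y = 2 * α * ∫ y, (curl U y) 2 * m y := by
  set H : EuclideanSpace ℝ (Fin 3) → ℝ := fun z => headPressure (1 / 2) U P z - α * ⟪rotGen z, U z⟫
    with hH
  obtain ⟨iΩ, i3, h₁, h₂, h₃⟩ :=
    twisted_integrability hU hP hm hC₀ hK hUb hDU hΔU heq hm0 hmup hmD (α := α)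
  have hHs : ContDiff ℝ ∞ H := contDiff_twistedHead hU hP α
  have hH2 : ContDiff ℝ 2 H := hHs.of_le (WithTop.coe_le_coe.2 le_top)
  have hbs : ContDiff ℝ ∞ (fun z => U z + (1 / 2 : ℝ) • z - α • rotGen z) :=
    ((hU.add (contDiff_id.const_smul (1 / 2 : ℝ))).sub (rotGenL.contDiff.const_smul α) :
      ContDiff ℝ ∞ (fun z => U z + (1 / 2 : ℝ) • z - α • rotGen z))
  have hb1 : ContDiff ℝ 1 (fun z => U z + (1 / 2 : ℝ) • z - α • rotGen z) :=
    hbs.of_le (WithTop.coe_le_coe.2 le_top)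
  have iΩn : Integrable (fun x => -(‖curl U x‖ ^ 2 * m x)) := iΩ.neg
  have i3c : Integrable (fun x => 2 * α * ((curl U x) 2 * m x)) := i3.const_mul (2 * α)
  have ef : (fun x => m x * (-(Δ H) x + fderiv ℝ H x (U x + (1 / 2 : ℝ) • x - α • rotGen x))) =
      fun x => -(‖curl U x‖ ^ 2 * m x) + 2 * α * ((curl U x) 2 * m x) := by
    funext x; rw [hpt x]; ring
  have hint : Integrable
      (fun x => m x * (-(Δ H) x + fderiv ℝ H x (U x + (1 / 2 : ℝ) • x - α • rotGen x))) := by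
    rw [ef]; exact iΩn.add i3c
  have hzero := integral_weight_mul_drift_eq_zero hH2 hm hb1 hker hint h₁ h₂ h₃
  rw [ef, integral_add iΩn i3c, integral_neg, integral_const_mul] at hzero
  exact ⟨iΩ, i3, neg_add_eq_zero.1 hzero⟩

/-- **Stub B3 (`stub_solitonLaws`): the `C`-free soliton enstrophy law `∫|curl U|² m ≤ 4α²` and
the identity `∫|curl U|² m = 2α∫(curl U)₂ m`** for a Type I RSS classical solution
`u = pvAnsatz α U` on `[−1, 0)` and a conjugate density `m` of `L_α`, GIVEN the twisted head
identity (stub B1) as hypothesis. Proof: `rss_profile_system` and `rss_profile_bounds` supply a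
smooth pressure with (1.8a), `U ∈ C^∞` and `‖U‖, ‖DU‖, ‖ΔU‖` bounded; B1 gives the pointwise
identity; `weighted_twisted_identity` integrates it against `m`; the law is
`integral_curl_sq_mul_le_of_identity`. [cite: PineauVicol2026, (5.4) (arXiv:2607.09619 p. 13)] -/
theorem stub_solitonLaws :
    (∀ (α : ℝ) (U : EuclideanSpace ℝ (Fin 3) → EuclideanSpace ℝ (Fin 3)) (P : EuclideanSpace ℝ (Fin 3) → ℝ), ContDiff ℝ (⊤ : ℕ∞) U → ContDiff ℝ (⊤ : ℕ∞) P → Literature.Analysis.FluidPDE.VectorCalculus.IsDivFree U → (∀ y : EuclideanSpace ℝ (Fin 3), α • (Literature.Analysis.FluidPDE.rotGen (U y) - fderiv ℝ U y (Literature.Analysis.FluidPDE.rotGen y)) + (1 / 2 : ℝ) • U y + (1 / 2 : ℝ) • fderiv ℝ U y y - Laplacian.laplacian U y + fderiv ℝ U y (U y) + gradient P y = 0) → ∀ y : EuclideanSpace ℝ (Fin 3), -(Laplacian.laplacian (fun z => Literature.Analysis.FluidPDE.headPressure (1 / 2) U P z - α * inner ℝ (Literature.Analysis.FluidPDE.rotGen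 z) (U z)) y) + fderiv ℝ (fun z => Literature.Analysis.FluidPDE.headPressure (1 / 2) U P z - α * inner ℝ (Literature.Analysis.FluidPDE.rotGen z) (U z)) y (U y + (1 / 2 : ℝ) • y - α • Literature.Analysis.FluidPDE.rotGen y) = -‖Literature.Analysis.FluidPDE.curl U y‖ ^ 2 + 2 * α * (Literature.Analysis.FluidPDE.curl U y) 2) →
    ∀ (C₀ α : ℝ) (u : ℝ → EuclideanSpace ℝ (Fin 3) → EuclideanSpace ℝ (Fin 3)) (p : ℝ → EuclideanSpace ℝ (Fin 3) → ℝ) (U : EuclideanSpace ℝ (Fin 3) → EuclideanSpace ℝ (Fin 3)) (m : EuclideanSpace ℝ (Fin 3) → ℝ) (c M₁ : ℝ), Literature.Analysis.FluidPDE.IsClassicalNSSolutionOn (Set.Ico (-1) 0) 1 0 u p → (∀ t ∈ Set.Ico (-1 : ℝ) 0, ∀ x : EuclideanSpace ℝ (Fin 3), ‖u t x‖ ≤ C₀ / (‖x‖ + Real.sqrt (-t))) → ContDiff ℝ 2 U → (∀ t ∈ Set.Ico (-1 : ℝ) 0, ∀ x : EuclideanSpace ℝ (Fin 3), u t x = Literature.Analysis.FluidPDE.pvAnsatz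 α (fun y _ => U y) t x) → (ContDiff ℝ 2 m ∧ (∀ y, 0 < m y) ∧ (∫ y, m y = 1) ∧ (∀ y, c * Real.exp (-(7 / 16 : ℝ) * ‖y‖ ^ 2) ≤ m y) ∧ (∀ y, m y ≤ M₁ * Real.exp (-(1 / 16 : ℝ) * ‖y‖ ^ 2)) ∧ (∃ M₂ : ℝ, ∀ y, ‖fderiv ℝ m y‖ ≤ M₂ * Real.exp (-(1 / 32 : ℝ) * ‖y‖ ^ 2)) ∧ (∀ y, Laplacian.laplacian m y + Literature.Analysis.FluidPDE.VectorCalculus.divergence (fun z => m z • (U z + (1 / 2 : ℝ) • z - α • Literature.Analysis.FluidPDE.rotGen z)) y = 0)) → (∫ y, ‖Literature.Analysis.FluidPDE.curl U y‖ ^ 2 * m y ≤ 4 * α ^ 2) ∧ (∫ y, ‖Literature.Analysis.FluidPDE.curl U y‖ ^ 2 * m y = 2 * α * ∫ y, (Literature.Analysis.FluidPDE.curl U y) 2 * m y) := by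
  intro h1 C₀ α u p U m c M₁ hsol hI _hU hans hm
  obtain ⟨hm2, hm0, hm1, -, hmup, ⟨M₂, hmD⟩, hker⟩ := hm
  obtain ⟨P, hUs, hPs, hdiv, heq⟩ := rss_profile_system α u p U hsol hans
  obtain ⟨hC₀, hUb, K, hK, hKb⟩ := rss_profile_bounds hsol hI hans
  have hpt := h1 α U P hUs hPs hdiv heq
  obtain ⟨iΩ, i3, hid⟩ := weighted_twisted_identity hUs hPs hm2 hC₀ hK hUb (fun y => (hKb y).1)
    (fun y => (hKb y).2) heq hm0 hmup hmD hker hpt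
  have hcurlc : Continuous (curl U) := by
    have e : curl U = fun y => curlCLM (fderiv ℝ U y) := funext fun y => curl_eq_curlCLM U y
    rw [e]
    exact curlCLM.continuous.comp (hUs.continuous_fderiv (by simp))
  exact ⟨integral_curl_sq_mul_le_of_identity hcurlc hm2.continuous hm0 hm1 iΩ i3 hid, hid⟩

end Summit.NavierStokesRegularity.NavierStokesRegularity.Theorems

end
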